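import Summits.BirchSwinnertonDyer.BirchSwinnertonDyer.Theorems.ClassRecordThreeCornerAtThreeShimuraCarrierOfNoTorsion
import Summits.BirchSwinnertonDyer.BirchSwinnertonDyer.Theorems.ClassRecordThreeCornerAtThreeShimuraWalkPresentationTransfer
import Summits.BirchSwinnertonDyer.BirchSwinnertonDyer.Theorems.ClassRecordThreeCornerAtThreeShimuraWalkDefs
import HarnessLib

/-!
# Carrier K4e for the Jetchev WALK, THIRD issue: keyed on `ShimuraWalk.LabelsAt`, with the CONVERSE divisibility bridge «one presentation ⟹ all»
# and admissibility ∕ invariance at EVERY depth (cell `bsd-stepL`, seat `bsd-stepL-corner3-p2` g8 = WIDTH-LEVER lane B;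
# `--supports stmt-BirchSwinnertonDyer-21420 --as helper`; supersedes p594479 `…ShimuraCarrierOfNoTorsionWalk` for the port, which stays valid)

WHY (PORT-SPEC §3c (a), HOME/corner3/g7/CORNER3-G7.md; g8). p594479 = g5's image-keyed carrier `hpointsRk_of_shimuraLabels_of_noTorsion` VERBATIM
+ clause (1) «`ShimuraWalk.PDiv hK ι W y p m μ → ∃ B ∈ A m, p^μ·B = Pt m`» + clause (2) «`A m = E(emb m)(E(K[m]))`». The dictionary entries
hκ0 ∕ hκt of the engines (p593233 ∕ p593074; `…ShimuraWalkExactOrder`) need the CONVERSE of (1) — from `Pt m ∈ p^μ·A m` to `p^μ ∣ P(σ′, H′, f′)`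
for EVERY presentation — which is the «one ⟹ all» transfer `ShimuraWalk.exists_smul_eq_kolyvaginPoint_of_presentation` (p596384, Gross 3.6
coset transfer) applied to the carrier's OWN (hidden, transversal) presentation; only the carrier can apply it. THIS FILE = p594479 with
(i) the five labels packaged as ONE hypothesis `hL : ShimuraWalk.LabelsAt W N K ι yK y ε` (the port targets' binder, p592703), and three
more clauses at every admissible `m`: (3) «`μ ≤ M + k → (∃ B ∈ A m, p^μ·B = Pt m) → ShimuraWalk.PDiv hK ι W y p m μ`»; (4) `A m` is
admissible for EVERY `p^n`; (5) `Pt m ∈ invPoints (A m) (p^n)` for EVERY `n ≥ 1` such that the prime factors of `m` have Gross depth `≥ n`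
(`FrobEqFrobInfty W K (p^n)`) — so that the class level `p^k` of the engines is decoupled from the carrier's fixed `M + k` (the root class
`c_{p^k}(Pt∕p^μ)` of `exists_root_of_mdiv_eq` needs `invPoints` at `p^{k+μ}` with `μ` varying along the walk). Proof = p594479's, plus
p596384 on the internal telescope for (3), and Gross (3.3) ∕ Prop. 3.7 (1) at depth `n` (`IsKolyvaginPrime.pow_dvd_add_one`,
`pow_dvd_frobeniusTrace_of_kolyvaginPrime`, `map_kolyvaginPoint_mem_invPoints`) for (5). HONEST FRAMING: one theorem; every label a hypothesis;
no definition ∕ fact ∕ sorry; no item closes; BSD is not proved by any of this; T7. Credit: shim-p1 g8 (K1–K4e), this seat g5∕g7.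
[cite: GrossLMS1991, §3 (3.3), Prop. 3.6, 3.7 (1), §4 (4.1)] [cite: McCallumLMS1991, §4 (4)–(6), §5 p. 303] [cite: BertoliniDarmon1996, §2]
[cite: Nekovar2007, (4.8), (4.9)] -/

noncomputable section

open scoped Classical

set_option linter.dupNamespace false

namespace Summit.BirchSwinnertonDyer.BirchSwinnertonDyer.Theorems.ShimuraKolyvaginOfImage

open WeierstrassCurve Field NumberField IsDedekindDomain Finset Literature.NumberTheory.EllipticCurves
  Literature.NumberTheory.GaloisRepresentations Literature.NumberTheory.EllipticCurves.KolyvaginCocycle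
  Literature.NumberTheory.EllipticCurves.KolyvaginEuler Literature.NumberTheory.EllipticCurves.RingClassField
  Literature.NumberTheory.EllipticCurves.ModularForms Summit.BirchSwinnertonDyer.Rank1Residual.X11b

variable {K : Type} [Field K] [NumberField K] {W : WeierstrassCurve ℚ}

set_option maxHeartbeats 1600000 in
/-- **K4e for the walk, third issue (labels packaged, converse bridge, every depth)**: p594479 VERBATIM with `hL : ShimuraWalk.LabelsAt …`
in place of the five label binders (witnesses `τ := liftAut c`, `A m := E(emb)(E(K[lev m]))`, `Pt m := E(emb)(P(lev m))`) ∧ at admissible `m`: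
(1) «`PDiv … m μ → ∃ B ∈ A m, p^μ·B = Pt m`», (2) «`A m = E(emb m)(E(K[m]))`», (3) «`μ ≤ M + k → (∃ B ∈ A m, p^μ·B = Pt m) → PDiv … m μ`»
(p596384 on the carrier's own presentation), (4) `A m` admissible for every `p^n`, (5) `Pt m ∈ invPoints (A m) (p^n)` at every depth `n ≥ 1` of `m`.
[cite: GrossLMS1991, §3 (3.3), Prop. 3.6, 3.7 (1), §4 (4.1)] [cite: McCallumLMS1991, §4 (4)–(6), §5 p. 303] [cite: BertoliniDarmon1996, §2] -/
theorem hpointsRk_of_labelsAt_of_noTorsion_walkDepth (hK : IsImaginaryQuadratic K) (ι : K →+* ℂ) {N : ℕ} [NeZero N]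
    [W.IsElliptic] [W.IsGloballyMinimal] (hN : W.conductorNorm ℤ = N)
    (Dt : ModularParametrizationData W N) {p : ℕ} (hp : p.Prime) (hp2 : p ≠ 2)
    (htor : ∀ k' : ℕ, k' ≠ 0 → ¬ p ∣ k' →
      ∀ (n' : ℕ) (a : (W.baseChange (ringClassField K ι k')).toAffine.Point),
        ((p ^ n' : ℕ) : ℤ) • a = 0 → a = 0)
    (y : (m : ℕ) → (W.baseChange (ringClassField K ι m)).toAffine.Point)
    {yK : (W.baseChange K).toAffine.Point} {ε : ℤ} (hL : ShimuraWalk.LabelsAt W N K ι yK y ε) :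
    ∀ (k : ℕ) {M : ℕ} (_hM : 1 ≤ M)
      (hdiv : ∀ Q : geomPoints (W.baseChange K), ∃ R, ((p ^ M : ℕ) : ℤ) • R = Q)
      (c : K ≃ₐ[ℚ] K) (_hc : c ≠ 1),
      ∃ (ε : ℤ) (τ : AlgebraicClosure K ≃+* AlgebraicClosure K) (hτ : IsLiftOfAut c τ)
        (A : ℕ → AddSubgroup (geomPoints (W.baseChange K)))
        (hA : ∀ m, KolyvaginCocycle.IsAdmissible (Field.absoluteGaloisGroup K) (A m)
          ((p ^ M : ℕ) : ℤ))
        (emb : ∀ m : ℕ, ringClassField K ι m →ₐ[K] AlgebraicClosure K)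
        (Pt : ℕ → geomPoints (W.baseChange K))
        (hPt : ∀ m, Pt m ∈
          KolyvaginCocycle.invPoints (Field.absoluteGaloisGroup K) (A m) ((p ^ M : ℕ) : ℤ)),
        (ε = 1 ∨ ε = -1) ∧
        IsOfFinAddOrder (Affine.Point.map (W' := W) (c : K →ₐ[ℚ] K) yK - ε • yK) ∧
        (∀ m, ∀ a ∈ A m, hτ.pointsMap W a ∈ A m) ∧
        Pt 1 = toGeomPoints (W.baseChange K) yK ∧
        (∀ m, m ≠ 0 → ∀ a ∈ A m, ∀ Φ : Field.absoluteGaloisGroup K,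
          (∀ x : ringClassField K ι m, Φ • emb m x = emb m x) → Φ • a = a) ∧
        (∀ m, KolyvaginCocycle.IsAdmissible (Field.absoluteGaloisGroup K) (A m)
          ((p ^ (M + k) : ℕ) : ℤ)) ∧
        (∀ m : ℕ, Squarefree m →
          (∀ q ∈ m.primeFactors, IsKolyvaginPrime N W K p q ∧ FrobEqFrobInfty W K (p ^ (M + k)) q) →
          Pt m ∈ KolyvaginCocycle.invPoints (Field.absoluteGaloisGroup K) (A m)
            ((p ^ (M + k) : ℕ) : ℤ) ∧
          (∃ B ∈ A m, hτ.pointsMap W (Pt m) =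
            (ε * (-1) ^ m.primeFactors.card) • Pt m + ((p ^ M : ℕ) : ℤ) • B) ∧
          (∀ ℓ : ℕ, ℓ.Prime → ℓ ∣ m → ∀ v : HeightOneSpectrum (𝓞 K), (ℓ : 𝓞 K) ∈ v.asIdeal →
            ∀ a : ℕ, (((p : ℤ) ^ a) •
                kolyvaginClass (W.baseChange K) _ hdiv (hA m) (Pt m) (hPt m) ∈
                selmerLocalKer (W.baseChange K) (v.adicCompletion K) ((p ^ M : ℕ) : ℤ) ↔
              ((p : ℤ) ^ a) • kolyvaginClass (W.baseChange K) _ hdiv (hA (m / ℓ)) (Pt (m / ℓ))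
                  (hPt (m / ℓ)) ∈
                (W.baseChange K).torsionLocalKer (v.adicCompletion K) ((p ^ M : ℕ) : ℤ))) ∧
          (∀ μ : ℕ, ShimuraWalk.PDiv hK ι W y p m μ →
            ∃ B ∈ A m, ((p ^ μ : ℕ) : ℤ) • B = Pt m) ∧
          A m = (WeierstrassCurve.Affine.Point.map (W' := W) (emb m).toRingHom.toRatAlgHom :
            (W.baseChange (ringClassField K ι m)).toAffine.Point →+ geomPoints (W.baseChange K)).range ∧
          (∀ μ : ℕ, μ ≤ M + k → (∃ B ∈ A m, ((p ^ μ : ℕ) : ℤ) • B = Pt m) → ShimuraWalk.PDiv hK ι W y p m μ) ∧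
          (∀ n : ℕ, KolyvaginCocycle.IsAdmissible (Field.absoluteGaloisGroup K) (A m) ((p ^ n : ℕ) : ℤ)) ∧
          (∀ n : ℕ, 1 ≤ n → (∀ q ∈ m.primeFactors, FrobEqFrobInfty W K (p ^ n) q) →
            Pt m ∈ KolyvaginCocycle.invPoints (Field.absoluteGaloisGroup K) (A m) ((p ^ n : ℕ) : ℤ))) := by
  intro k M hM hdiv c hc
  obtain ⟨hε, hB2, hB3, hB3K, hB4, hB5⟩ := hL
  have hMk : 1 ≤ M + k := hM.trans (Nat.le_add_right M k); have hpMk : ((p ^ M : ℕ) : ℤ) ∣ ((p ^ (M + k) : ℕ) : ℤ) := Int.natCast_dvd_natCast.mpr (pow_dvd_pow p (Nat.le_add_right M k))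
  let Kol : ℕ → Prop := fun m ↦ Squarefree m ∧
    ∀ q ∈ m.primeFactors, IsKolyvaginPrime N W K p q ∧ FrobEqFrobInfty W K (p ^ (M + k)) q
  let lev : ℕ → ℕ := fun m ↦ if Kol m then m else 1
  have hKol1 : Kol 1 := ⟨squarefree_one, by simp⟩
  have hlev : ∀ m, Kol (lev m) :=
    fun m ↦ by by_cases h : Kol m <;> simp only [lev, if_pos, if_neg, h, hKol1, not_false_eq_true]
  have hlev_eq : ∀ m, Kol m → lev m = m := fun m h ↦ if_pos h
  have hlev0 : ∀ m, lev m ≠ 0 := fun m ↦ Squarefree.ne_zero (hlev m).1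
  have hlevdvd : ∀ m, lev m ∣ m := fun m ↦ by
    by_cases h : Kol m
    · rw [hlev_eq m h]
    · rw [show lev m = 1 from if_neg h]; exact one_dvd m
  have hinert : ∀ m, ∀ q ∈ (lev m).primeFactors, (Ideal.span {(q : 𝓞 K)}).IsPrime :=
    fun m q hq ↦ ((hlev m).2 q hq).1.2.2.2.2.1
  have hKdiv : ∀ (m k' : ℕ), k' ∣ lev m → Kol k' := fun m k' hk ↦ ⟨(hlev m).1.squarefree_of_dvd hk,
    fun q hq ↦ (hlev m).2 q (Nat.primeFactors_mono hk (hlev0 m) hq)⟩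
  have hKolM : ∀ (m k' : ℕ), k' ∣ lev m →
      ∀ q ∈ k'.primeFactors, IsKolyvaginPrime N W K p q ∧ FrobEqFrobInfty W K (p ^ M) q := fun m k' hk q hq ↦
    ⟨((hKdiv m k' hk).2 q hq).1, ((hKdiv m k' hk).2 q hq).2.of_dvd (pow_dvd_pow p (Nat.le_add_right M k))⟩
  have hguard : ∀ (m k' : ℕ), k' ∣ lev m →
      ∀ q ∈ k'.primeFactors, ¬ q ∣ N ∧ (Ideal.span {(q : 𝓞 K)}).IsPrime :=
    fun m k' hk q hq ↦ ⟨((hKdiv m k' hk).2 q hq).1.2.1, ((hKdiv m k' hk).2 q hq).1.2.2.2.2.1⟩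
  have hk'0 : ∀ (m k' : ℕ), k' ∣ lev m → k' ≠ 0 := fun m k' hk ↦ ne_zero_of_dvd_ne_zero (hlev0 m) hk
  choose res gen Tr emb σ H f π j e h1 h4 h5 he1 hβ hord hj hπρ hfsec hHρ hdict hjunk using
    fun m : ℕ ↦ exists_ringClassLevelData hK ι (hlev m).1 (hinert m) W
  letI hcg : ∀ k', CommGroup (ringClassGal ι k') := fun k' ↦ { (inferInstance : Group (ringClassGal ι k')) with
    mul_comm := fun a b ↦ (KolyvaginH44.isMulCommutative_ringClassGal' hK ι k').is_comm.comm a b }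
  haveI hfin : ∀ k', Finite (ringClassGal ι k') := KolyvaginH44.finite_ringClassGal hK ι
  letI act : ∀ k', DistribMulAction (ringClassGal ι k')
      ((W.baseChange (ringClassField K ι k')).toAffine.Point) := fun k' ↦
    DistribMulAction.compHom _ ((pointGalHom W (ringClassField K ι k')).comp (ringClassGal ι k').subtype)
  letI hft : ∀ m k', Fintype (ringClassGal ι k' ⧸ H m k') := fun m k' ↦ Fintype.ofFinite _
  have hsmul : ∀ (k') (g : ringClassGal ι k') (Q : (W.baseChange (ringClassField K ι k')).toAffine.Point),
      g • Q = pointGalHom W (ringClassField K ι k') (g : ringClassField K ι k' ≃ₐ[ℚ] ringClassField K ι k') Q :=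
    fun _ _ _ ↦ rfl
  have hmul : ∀ (k') (a b : ringClassField K ι k' ≃ₐ[ℚ] ringClassField K ι k')
      (Q : (W.baseChange (ringClassField K ι k')).toAffine.Point), pointGalHom W (ringClassField K ι k') (a * b) Q =
        pointGalHom W (ringClassField K ι k') a (pointGalHom W (ringClassField K ι k') b Q) := fun k' a b Q ↦ by rw [map_mul]; rfl
  set ρ : ∀ k', ringClassGal ι k' →* (ringClassField K ι k' ≃ₐ[ℚ] ringClassField K ι k') :=
    fun k' ↦ (ringClassGal ι k').subtype with hρdef
  have hρi : ∀ k', Function.Injective (ρ k') := fun k' ↦ (ringClassGal ι k').subtype_injective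
  have hj' : ∀ (m k') (γ : absoluteGaloisGroup K)
      (a : (W.baseChange (ringClassField K ι k')).toAffine.Point),
      j m k' (π m k' γ • a) = γ • j m k' a := fun m k' γ a ↦ by rw [hsmul]; exact hj m k' γ a
  have hπρ' : ∀ (m k') (t : absoluteGaloisGroup K) (x : ringClassField K ι k'),
      t • e m k' x = e m k' (ρ k' (π m k' t) x) := fun m k' t x ↦ hπρ m k' t x
  have hjQ : ∀ (m k' : ℕ) (hk : k' ∣ lev m) (Q : (W.baseChange (ringClassField K ι k')).toAffine.Point),
      j m k' Q = WeierstrassCurve.Affine.Point.map (W' := W) (emb m k' hk).toRatAlgHom Q :=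
    fun m k' hk Q ↦ DFunLike.congr_fun (hdict m k' hk).1 Q
  have hσres : ∀ (m k' : ℕ) (hk : k' ∣ lev m), ∀ q ∈ k'.primeFactors,
      (σ m k' q : ringClassField K ι k' ≃ₐ[ℚ] ringClassField K ι k') = res m k' (gen m q) :=
    fun m k' hk ↦ (hdict m k' hk).2.1
  have hfS : ∀ (m k' : ℕ) (hk : k' ∣ lev m) (c' : ringClassGal ι k' ⧸ H m k'),
      (f m k' c' : ringClassField K ι k' ≃ₐ[ℚ] ringClassField K ι k') ∈
        (Tr m).image (fun t ↦ res m k' t) := fun m k' hk ↦ (hdict m k' hk).2.2.1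
  have hz : ∀ (m k' : ℕ) (hk : k' ∣ lev m), ∀ q ∈ k'.primeFactors,
      (Subgroup.zpowers (σ m k' q)).map (ρ k') = ringClassGalOver ι k' (k' / q) := by
    intro m k' hk q hq; rw [MonoidHom.map_zpowers]
    change Subgroup.zpowers (σ m k' q : ringClassField K ι k' ≃ₐ[ℚ] ringClassField K ι k') = _
    rw [hσres m k' hk q hq]; exact (h4 m k' hk q hq).1
  have hzz : ∀ (m k' : ℕ) (hk : k' ∣ lev m), ∀ q ∈ k'.primeFactors,
      Subgroup.zpowers (res m k' (gen m q)) = ringClassGalOver ι k' (k' / q) :=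
    fun m k' hk q hq ↦ (h4 m k' hk q hq).1
  have hSsub : ∀ (m k' : ℕ) (_ : k' ∣ lev m), ∀ s ∈ (Tr m).image (fun t ↦ res m k' t),
      s ∈ ringClassGal ι k' := by
    intro m k' hk s hs; obtain ⟨t, -, rfl⟩ := Finset.mem_image.mp hs
    exact RingClassTower.restrictHom_mem_ringClassGal ι (h1 m k' hk) t
  have hSρ : ∀ (m k' : ℕ) (hk : k' ∣ lev m),
      ((Tr m).image (fun t ↦ res m k' t) :
          Set (ringClassField K ι k' ≃ₐ[ℚ] ringClassField K ι k')) ⊆ Set.range (ρ k') :=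
    fun m k' hk s hs ↦ ⟨⟨s, hSsub m k' hk s hs⟩, rfl⟩
  have hX : ∀ (m k' : ℕ), k' ∣ lev m → ∀ (n' : ℕ) (a : (W.baseChange (ringClassField K ι k')).toAffine.Point),
      ((p ^ n' : ℕ) : ℤ) • a = 0 → a = 0 := fun m k' hk n' a ha ↦ htor k' (hk'0 m k' hk)
    (fun hpk ↦ ((hlev m).2 p (Nat.mem_primeFactors.mpr ⟨hp, hpk.trans hk, hlev0 m⟩)).1.2.2.2.1 rfl) n' a ha
  have hjinj : ∀ (m k' : ℕ) (_ : k' ∣ lev m), Function.Injective (j m k') := by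
    intro m k' hk a b hab; rw [hjQ m k' hk, hjQ m k' hk] at hab
    exact WeierstrassCurve.Affine.Point.map_injective (W' := W) (emb m k' hk).toRatAlgHom hab
  have hAdiv : ∀ (m k' : ℕ) (_ : k' ∣ lev m) (n' : ℕ),
      IsAdmissible (absoluteGaloisGroup K) (j m k').range ((p ^ n' : ℕ) : ℤ) := fun m k' hk n' ↦
    isAdmissible_range_of_galoisEquivariant (π m k') (j m k') (hj' m k') (hjinj m k' hk)
      (hX m k' hk n')
  have hAzero : ∀ (m k' : ℕ), ¬ k' ∣ lev m → ∀ n' : ℤ,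
      IsAdmissible (absoluteGaloisGroup K) (j m k').range n' := by
    intro m k' hk n'; rw [hjunk m k' hk]
    exact ⟨fun g x hx ↦ by obtain ⟨a, rfl⟩ := hx; exact ⟨a, by rw [AddMonoidHom.zero_apply, smul_zero]⟩,
      fun x hx _ ↦ by obtain ⟨a, rfl⟩ := hx; rw [AddMonoidHom.zero_apply]⟩
  have hAt : ∀ (m k' : ℕ), IsAdmissible (absoluteGaloisGroup K) (j m k').range ((p ^ M : ℕ) : ℤ) :=
    fun m k' ↦ if hk : k' ∣ lev m then hAdiv m k' hk M else hAzero m k' hk _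
  have hgen : ∀ (m k' : ℕ) (_ : k' ∣ lev m),
      H m k' ≤ Subgroup.closure (σ m k' '' (k'.primeFactors : Set ℕ)) := fun m k' hk ↦
    le_closure_of_map_zpowers hK ι ((hlev m).1.squarefree_of_dvd hk) (σ m k') (H m k') (ρ k') (hρi k')
      (hz m k' hk) (fun h hh ↦ hHρ m k' h hh)
  have hdvdMk : ∀ (m k' : ℕ) (_ : k' ∣ lev m), ∀ ℓ ∈ k'.primeFactors,
      ((p ^ (M + k) : ℕ) : ℤ) ∣ ((ℓ + 1 : ℕ) : ℤ) := fun m k' hk ℓ hℓ ↦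
    (IsKolyvaginPrime.pow_dvd_add_one W hp ((hKdiv m k' hk).2 ℓ hℓ).1 hMk ((hKdiv m k' hk).2 ℓ hℓ).2).1
  have hB4w : ∀ (m k' : ℕ) (_ : k' ∣ lev m), ∀ ℓ ∈ k'.primeFactors,
      ∀ σ₀ : ringClassField K ι k' ≃ₐ[ℚ] ringClassField K ι k',
      Subgroup.zpowers σ₀ = ringClassGalOver ι k' (k' / ℓ) →
      ∃ y' : (W.baseChange (ringClassField K ι k')).toAffine.Point,
        ∑ i ∈ Finset.range (ℓ + 1), pointGalHom W (ringClassField K ι k') (σ₀ ^ i) (y k') =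
          W.frobeniusTrace ℓ • y' := by
    intro m k' hk ℓ hℓ σ₀ hσ₀
    have hle : ringClassField K ι (k' / ℓ) ≤ ringClassField K ι k' :=
      ringClassField_mono hK ι (Nat.div_dvd_of_dvd (Nat.dvd_of_mem_primeFactors hℓ)) (hk'0 m k' hk)
    exact ⟨_, hB4 k' (hKdiv m k' hk).1 (hguard m k' hk) ℓ hℓ hle σ₀ hσ₀⟩
  have htrg : ∀ (m k' : ℕ) (_ : k' ∣ lev m) (n' : ℤ), ∀ ℓ ∈ k'.primeFactors, n' ∣ W.frobeniusTrace ℓ →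
      grAct ((W.baseChange (ringClassField K ι k')).toAffine.Point) (traceElt (σ m k' ℓ) ℓ) (y k') ∈
        zsmulRange ((W.baseChange (ringClassField K ι k')).toAffine.Point) n' := by
    intro m k' hk n' ℓ hℓ haℓ
    obtain ⟨y', hy'⟩ := hB4w m k' hk ℓ hℓ (σ m k' ℓ : ringClassField K ι k' ≃ₐ[ℚ] ringClassField K ι k')
      (by rw [hσres m k' hk ℓ hℓ]; exact hzz m k' hk ℓ hℓ)
    have hrel : grAct ((W.baseChange (ringClassField K ι k')).toAffine.Point) (traceElt (σ m k' ℓ) ℓ)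
        (y k') = W.frobeniusTrace ℓ • y' := by
      rw [grAct_traceElt, ← hy']; exact Finset.sum_congr rfl fun i _ ↦ by rw [hsmul, Subgroup.coe_pow]
    exact grAct_traceElt_mem_of_eq_smul hrel haℓ
  have htrn : ∀ (m k' : ℕ) (_ : k' ∣ lev m) (n' : ℤ) (_ : n' ∣ ((p ^ (M + k) : ℕ) : ℤ)),
      ∀ ℓ ∈ k'.primeFactors,
      grAct ((W.baseChange (ringClassField K ι k')).toAffine.Point) (traceElt (σ m k' ℓ) ℓ) (y k') ∈
        zsmulRange ((W.baseChange (ringClassField K ι k')).toAffine.Point) n' := fun m k' hk n' hn' ℓ hℓ ↦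
    htrg m k' hk n' ℓ hℓ (hn'.trans (pow_dvd_frobeniusTrace_of_kolyvaginPrime (K := K) Dt hp hMk
      ((hKdiv m k' hk).2 ℓ hℓ).1 ((hKdiv m k' hk).2 ℓ hℓ).2))
  have hPtn : ∀ (m k' : ℕ) (_ : k' ∣ lev m) (n' : ℤ) (_ : n' ∣ ((p ^ (M + k) : ℕ) : ℤ)),
      j m k' (kolyvaginPoint (σ m k') k'.primeFactors (f m k') (y k')) ∈
        invPoints (absoluteGaloisGroup K) (j m k').range n' := fun m k' hk n' hn' ↦
    map_kolyvaginPoint_mem_invPoints (hfsec m k') (hgen m k' hk) (hord m k')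
      (fun ℓ hℓ ↦ hn'.trans (hdvdMk m k' hk ℓ hℓ)) (htrn m k' hk n' hn') (π m k') (j m k') (hj' m k')
  have hPtt : ∀ (m k' : ℕ), j m k' (kolyvaginPoint (σ m k') k'.primeFactors (f m k') (y k')) ∈
      invPoints (absoluteGaloisGroup K) (j m k').range ((p ^ M : ℕ) : ℤ) := by
    intro m k'; by_cases hk : k' ∣ lev m; · exact hPtn m k' hk _ hpMk
    rw [hjunk m k' hk, AddMonoidHom.zero_apply]; exact AddSubgroup.zero_mem _
  have hIt : ∀ (m k' : ℕ), ∀ v : HeightOneSpectrum (𝓞 K), (k' : 𝓞 K) ∉ v.asIdeal →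
      ∀ 𝔐 ∈ v.localPrimesAbove, ∀ t ∈ 𝔐.inertia (absoluteGaloisGroup (v.adicCompletion K)),
        resGal (K := K) (v.adicCompletion K) t •
            j m k' (kolyvaginPoint (σ m k') k'.primeFactors (f m k') (y k')) =
          j m k' (kolyvaginPoint (σ m k') k'.primeFactors (f m k') (y k')) := by
    intro m k' v hv 𝔐 h𝔐 t ht
    have hk0 : k' ≠ 0 := by rintro rfl; exact hv (by rw [Nat.cast_zero]; exact v.asIdeal.zero_mem)
    exact resGal_smul_map_eq_self_of_galoisDictionary hK ι hk0 (π m k') (j m k') (hj' m k') (e m k')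
      (ρ k') (hρi k') (hπρ' m k') hv h𝔐 ht _
  have h37t : ∀ m : ℕ, ∀ k' : ℕ, k' ∣ lev m → Squarefree k' →
      (∀ q ∈ k'.primeFactors, IsKolyvaginPrime N W K p q ∧ FrobEqFrobInfty W K (p ^ M) q) →
      ∀ ℓ : ℕ, ℓ.Prime → ℓ ∣ k' →
      ℓ ∈ k'.primeFactors ∧ ∃ y' : (W.baseChange (ringClassField K ι k')).toAffine.Point,
        j m k' (kolyvaginPoint (σ m k') ((k'.primeFactors).erase ℓ) (f m k') y') =
          j m (k' / ℓ) (kolyvaginPoint (σ m (k' / ℓ)) (k' / ℓ).primeFactors (f m (k' / ℓ))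
            (y (k' / ℓ))) ∧
        grAct _ (traceElt (σ m k' ℓ) ℓ) (y k') = W.frobeniusTrace ℓ • y' ∧
        ∀ [Fact ℓ.Prime] (hΔ : ¬ (ℓ : ℤ) ∣ minimalDiscriminantInt W)
          (φ₀ : absoluteGaloisGroup (ZMod ℓ)), (∀ x : AlgebraicClosure (ZMod ℓ), φ₀ • x = x ^ ℓ) →
          ∀ γ : ringClassGal ι k',
            geomReduction hΔ ((RatClosure.pointsEquiv (K := K) W).symm (j m k' (γ • y k'))) =
              φ₀ • geomReduction hΔ ((RatClosure.pointsEquiv (K := K) W).symm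
                (j m k' (γ • y'))) := by
    intro m
    refine h37_of_labels hK ι p M (n := lev m) (fun k' _ ↦ y k')
      (fun k' _ q ↦ res m k' (gen m q)) (fun k' _ ↦ (Tr m).image (fun t ↦ res m k' t))
      (fun k' hk ↦ hSsub m k' hk) (fun k' hk ↦ h5 m k' hk) (fun k' _ ↦ j m k') ?_ ?_ ?_
      (σ m) (fun k' ↦ k'.primeFactors) (H m) (f m) (fun k' ↦ y k') (j m) ρ hρi
      (fun _ ↦ AddEquiv.refl _) (fun k' _ g a ↦ hsmul k' g a) (fun _ _ _ ↦ rfl) (fun _ _ ↦ rfl)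
      (fun k' hk ↦ hσres m k' hk) (fun _ _ ↦ rfl) (fun k' _ ↦ hfsec m k') (fun k' hk ↦ hfS m k' hk)
      (fun k' _ ↦ hHρ m k') (fun k' _ g ↦ g.2) (fun k' hk ↦ hSρ m k' hk)
    · intro k' hk ℓ hℓ hle
      have hd : k' / ℓ ∣ k' := Nat.div_dvd_of_dvd (Nat.dvd_of_mem_primeFactors hℓ)
      obtain ⟨hi, hii⟩ := hβ m k' hk (k' / ℓ) hd hle (k' / ℓ) (y (k' / ℓ))
      rw [hjQ m k' hk, hjQ m (k' / ℓ) (hd.trans hk), hi, hii]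
    · intro k' hk ℓ hℓ hle
      exact hB4 k' (hKdiv m k' hk).1 (hguard m k' hk) ℓ hℓ hle (res m k' (gen m ℓ)) (hzz m k' hk ℓ hℓ)
    · intro k' hk ℓ hℓ _ hΔ φ₀ hφ₀ hle γ hγ
      exact hB5 k' (hKdiv m k' hk).1 (hguard m k' hk) ℓ hℓ hΔ φ₀ hφ₀ hle (emb m k' hk) (he1 m k' hk)
        (j m k') (hdict m k' hk).1 γ hγ
  have h44t := fun m : ℕ ↦ h44_of_prop37_on_of_conductorNorm hK ι hN hp hp2 hM
    (W.exists_weilPairing_holds p) hdiv (σ m) (fun k' ↦ k'.primeFactors) (H m) (f m) (hord m)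
    (fun k' ↦ y k') (π m) (j m) (hj' m) (hAt m) (hPtt m) (hIt m) (fun k' ↦ k' ∣ lev m) (h37t m)
    (e m) ρ hρi (hπρ' m) (fun k' hk ↦ hz m k' hk)
  have hcmp : ∀ (m₁ k₁ : ℕ) (hk₁ : k₁ ∣ lev m₁) (m₂ k₂ : ℕ) (hk₂ : k₂ ∣ lev m₂) (_ : k₂ = k₁)
      (H' : AddSubgroup (galH1Torsion (W.baseChange K) ((p ^ M : ℕ) : ℤ))) (t : ℤ),
      t • kolyvaginClass (W.baseChange K) _ hdiv (hAt m₁ k₁)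
          (j m₁ k₁ (kolyvaginPoint (σ m₁ k₁) k₁.primeFactors (f m₁ k₁) (y k₁))) (hPtt m₁ k₁) ∈ H' ↔
        t • kolyvaginClass (W.baseChange K) _ hdiv (hAt m₂ k₂)
          (j m₂ k₂ (kolyvaginPoint (σ m₂ k₂) k₂.primeFactors (f m₂ k₂) (y k₂))) (hPtt m₂ k₂) ∈ H' := by
    intro m₁ k₁ hk₁ m₂ k₂ hk₂ hkk H' t; subst hkk
    exact zsmul_kolyvaginClass_mem_iff_of_presentations_of_pow_eq_one hK ι Dt hp hM
      ((hlev m₂).1.squarefree_of_dvd hk₂) (hKolM m₂ k₂ hk₂) hdiv hdiv (ρ k₂) (hρi k₂) (fun g ↦ g.2)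
      (fun g a ↦ hsmul k₂ g a) (y k₂) (hB4w m₂ k₂ hk₂)
      (σ m₂ k₂) (H m₂ k₂) (f m₂ k₂) ((Tr m₂).image (fun t ↦ res m₂ k₂ t))
      (fun h hh ↦ hHρ m₂ k₂ h hh) (hfsec m₂ k₂) (hfS m₂ k₂ hk₂) (hSsub m₂ k₂ hk₂) (hSρ m₂ k₂ hk₂)
      (h5 m₂ k₂ hk₂) (hz m₂ k₂ hk₂) (hord m₂ k₂) (emb m₂ k₂ hk₂) (he1 m₂ k₂ hk₂) (j m₂ k₂) (hdict m₂ k₂ hk₂).1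
      (hAt m₂ k₂) (hPtt m₂ k₂)
      (σ m₁ k₂) (H m₁ k₂) (f m₁ k₂) ((Tr m₁).image (fun t ↦ res m₁ k₂ t))
      (fun h hh ↦ hHρ m₁ k₂ h hh) (hfsec m₁ k₂) (hfS m₁ k₂ hk₁) (hSsub m₁ k₂ hk₁) (hSρ m₁ k₂ hk₁)
      (h5 m₁ k₂ hk₁) (hz m₁ k₂ hk₁) (emb m₁ k₂ hk₁) (he1 m₁ k₂ hk₁) (j m₁ k₂) (hdict m₁ k₂ hk₁).1
      (hAt m₁ k₂) (hPtt m₁ k₂) H' t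
  choose τm hτm using fun m : ℕ ↦ RingClassConj.exists_conj_algEquiv hK ι (hlev0 m)
  have hτm𝒢 : ∀ m, τm m ∉ ringClassGal ι (lev m) := fun m ↦ RingClassConj.conj_not_mem_ringClassGal (hτm m) hK
  choose Tc hTapp hT using fun m : ℕ ↦ KolyvaginConj.exists_addMonoidHom_map_smul_eq_inv_smul hK
    (hlev0 m) W (ρ (lev m)) (fun g ↦ g.2) (AddEquiv.refl _) (fun g a ↦ hsmul (lev m) g a) (hτm𝒢 m)
  have hT' : ∀ (m) (P : (W.baseChange (ringClassField K ι (lev m))).toAffine.Point),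
      Tc m P = pointGalHom W (ringClassField K ι (lev m)) (τm m) P := fun m P ↦ hTapp m P
  have hτ : IsLiftOfAut c (liftAut c) := isLiftOfAut_liftAut c
  choose rr hrr𝒢 hrres using fun m : ℕ ↦ exists_mem_ringClassGal_apply_ringHom_eq hK ι (hlev0 m)
    (emb m (lev m) dvd_rfl) (he1 m (lev m) dvd_rfl) hc hτ (hτm m)
  have hjτ : ∀ (m) (a : (W.baseChange (ringClassField K ι (lev m))).toAffine.Point),
      hτ.pointsMap W (j m (lev m) a) =
        j m (lev m) (Tc m ((⟨rr m, hrr𝒢 m⟩ : ringClassGal ι (lev m)) • a)) := by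
    intro m a
    have hg : ∀ x, liftAut c (emb m (lev m) dvd_rfl x) = emb m (lev m) dvd_rfl ((τm m * rr m) x) := fun x ↦ by
      rw [AlgEquiv.mul_apply]; exact hrres m x
    rw [pointsMap_map_ringHom_eq (emb m (lev m) dvd_rfl) (j m (lev m)) (hdict m (lev m) dvd_rfl).1 hτ
      hg a, hmul, hT', hsmul]
  have hτy : ∀ m, ∃ σ₁ : ringClassGal ι (lev m), Tc m (y (lev m)) - ε • σ₁ • y (lev m) ∈
      zsmulRange ((W.baseChange (ringClassField K ι (lev m))).toAffine.Point) ((p ^ M : ℕ) : ℤ) := by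
    intro m; obtain ⟨σ₁, hσ₁, hford⟩ := hB3 (lev m) (hlev0 m) (τm m) (hτm m)
    refine ⟨⟨σ₁, hσ₁⟩, ?_⟩; rw [hsmul, hT']
    exact KolyvaginTauEigen.mem_zsmulRange_of_isOfFinAddOrder hp hM (hX m (lev m) dvd_rfl M) hford
  choose σ₁ hσ₁ using hτy
  have hbot : ∀ (m₀ k₁ : ℕ) (hk : k₁ ∣ lev m₀), k₁ = 1 →
      j m₀ k₁ (kolyvaginPoint (σ m₀ k₁) k₁.primeFactors (f m₀ k₁) (y k₁)) =
        toGeomPoints (W.baseChange K) yK := by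
    rintro m₀ k₁ hk rfl
    exact map_kolyvaginPoint_one_eq_toGeomPoints ι (ρ 1) (hρi 1) (AddEquiv.refl _)
      (fun g a ↦ hsmul 1 g a) (fun h hh ↦ hHρ m₀ 1 h hh) (hSsub m₀ 1 hk) (hSρ m₀ 1 hk) (h5 m₀ 1 hk)
      (f m₀ 1) (hfsec m₀ 1) (hfS m₀ 1 hk) (σ m₀ 1) (y 1) (fun T hT ↦ hB2 T hT) (emb m₀ 1 hk)
      (he1 m₀ 1 hk) (j m₀ 1) (hdict m₀ 1 hk).1
  refine ⟨ε, liftAut c, hτ, fun m ↦ (j m (lev m)).range, fun m ↦ hAt m (lev m), fun m ↦ e m m,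
    fun m ↦ j m (lev m) (kolyvaginPoint (σ m (lev m)) (lev m).primeFactors (f m (lev m)) (y (lev m))),
    fun m ↦ hPtt m (lev m), hε, hB3K c hc, ?_, ?_, ?_, ?_, ?_⟩
  · exact fun m a ha ↦ pointsMap_mem_range_of_glue (Tc m) (j m (lev m)) hτ (hjτ m) ha
  · exact hbot 1 (lev 1) dvd_rfl (hlev_eq 1 hKol1)
  · intro m hm0 a ha Φ hΦ; obtain ⟨a₀, rfl⟩ := ha
    have hle : ringClassField K ι (lev m) ≤ ringClassField K ι m := ringClassField_mono hK ι (hlevdvd m) hm0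
    letI : Algebra K ℂ := ι.toAlgebra
    obtain ⟨gq, hgq⟩ := RingClassConj.exists_algEquiv_forall_apply_eq hK ι (hlev0 m)
      ((e m m : ringClassField K ι m →+* AlgebraicClosure K).comp
        ((RingClassField.inclusion ι hle).restrictScalars ℚ : ringClassField K ι (lev m) →+*
          ringClassField K ι m))
      (e m (lev m) : ringClassField K ι (lev m) →+* AlgebraicClosure K)
    have hΦ' : ∀ x : ringClassField K ι (lev m), Φ • e m (lev m) x = e m (lev m) x := fun x ↦ by
      have h1 : e m (lev m) x = e m m ((RingClassField.inclusion ι hle).restrictScalars ℚ (gq x)) := hgq x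
      rw [h1]; exact hΦ _
    exact smul_map_eq_self_of_galoisDictionary (π m (lev m)) (j m (lev m)) (hj' m (lev m))
      (e m (lev m)) (ρ (lev m)) (hρi (lev m)) (hπρ' m (lev m)) a₀ Φ hΦ'
  · exact fun m ↦ hAdiv m (lev m) dvd_rfl (M + k)
  · intro m hmsq hmkol
    have hlm : lev m = m := hlev_eq m ⟨hmsq, hmkol⟩
    refine ⟨hPtn m (lev m) dvd_rfl _ dvd_rfl, ?_, ?_, ?_, ?_, ?_, ?_, ?_⟩
    · obtain ⟨B, hB, hBeq⟩ := exists_pointsMap_map_kolyvaginPoint_eq_of_prop53 (hfsec m (lev m))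
        (hgen m (lev m) dvd_rfl) (hord m (lev m)) (fun ℓ hℓ ↦ hpMk.trans (hdvdMk m (lev m) dvd_rfl ℓ hℓ))
        (htrn m (lev m) dvd_rfl _ hpMk) (Tc m) (hT m) (hσ₁ m) (j m (lev m)) hτ (hjτ m)
      have hpf : (lev m).primeFactors.card = m.primeFactors.card := by rw [hlm]
      exact ⟨B, hB, by rw [← hpf]; exact hBeq⟩
    · intro ℓ hℓp hℓm v hv a
      have hℓlm : ℓ ∣ lev m := by rw [hlm]; exact hℓm
      rw [h44t m (lev m) dvd_rfl (hlev m).1 (hKolM m (lev m) dvd_rfl) ℓ hℓp hℓlm v hv a]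
      have hKol' : Kol (m / ℓ) := hKdiv m (m / ℓ) (by rw [hlm]; exact Nat.div_dvd_of_dvd hℓm)
      have hlev' : lev (m / ℓ) = lev m / ℓ := by rw [hlev_eq _ hKol', hlm]
      exact hcmp m (lev m / ℓ) (Nat.div_dvd_of_dvd hℓlm) (m / ℓ) (lev (m / ℓ)) dvd_rfl hlev' _ _
    · -- clause (1): the carrier's own presentation instantiates `PDiv`
      intro μ hPD
      have hPD' : ShimuraWalk.PDiv hK ι W y p (lev m) μ := by rw [hlm]; exact hPD
      obtain ⟨B', hB'⟩ := hPD' (σ m (lev m)) (H m (lev m)) (f m (lev m)) (hord m (lev m))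
        (fun q hq ↦ by rw [hσres m (lev m) dvd_rfl q hq]; exact hzz m (lev m) dvd_rfl q hq)
        (hfsec m (lev m)) (hHρ m (lev m))
      refine ⟨j m (lev m) B', ⟨B', rfl⟩, ?_⟩
      rw [← map_zsmul, hB']
    · have hrange : ∀ (k' : ℕ) (hk : k' ∣ lev m), (j m k').range =
          (WeierstrassCurve.Affine.Point.map (W' := W) (e m k').toRingHom.toRatAlgHom :
            (W.baseChange (ringClassField K ι k')).toAffine.Point →+ geomPoints (W.baseChange K)).range := by
        intro k' hk
        have hek : (e m k').toRingHom = emb m k' hk := RingHom.ext fun x ↦ (hdict m k' hk).2.2.2 x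
        rw [(hdict m k' hk).1, ← hek]
        exact rfl
      exact (hrange (lev m) dvd_rfl).trans (congrArg (fun k' : ℕ ↦
        (WeierstrassCurve.Affine.Point.map (W' := W) (e m k').toRingHom.toRatAlgHom :
          (W.baseChange (ringClassField K ι k')).toAffine.Point →+ geomPoints (W.baseChange K)).range) hlm)
    · rintro μ hμ ⟨B, ⟨B₀, rfl⟩, hB⟩ -- clause (3): «one presentation ⟹ all» (p596384) from the carrier's own presentation
      have hB₀ : ((p ^ μ : ℕ) : ℤ) • B₀ =
          kolyvaginPoint (σ m (lev m)) (lev m).primeFactors (f m (lev m)) (y (lev m)) :=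
        hjinj m (lev m) dvd_rfl (by rw [map_zsmul]; exact hB)
      suffices h : ShimuraWalk.PDiv hK ι W y p (lev m) μ by rwa [hlm] at h
      intro σ' H' _ f' h1 h2 h3 h4
      exact ShimuraWalk.exists_smul_eq_kolyvaginPoint_of_presentation hK ι Dt hp hMk (hlev m).1 (hlev m).2
        (ρ (lev m)) (hρi (lev m)) (fun g ↦ g.2) (AddEquiv.refl _) (fun g a ↦ hsmul (lev m) g a) (y (lev m))
        (hB4w m (lev m) dvd_rfl) (σ m (lev m)) (H m (lev m)) (f m (lev m))
        ((Tr m).image (fun t ↦ res m (lev m) t)) (fun h hh ↦ hHρ m (lev m) h hh) (hfsec m (lev m))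
        (hfS m (lev m) dvd_rfl) (hSsub m (lev m) dvd_rfl) (hSρ m (lev m) dvd_rfl) (h5 m (lev m) dvd_rfl)
        (hz m (lev m) dvd_rfl) (hord m (lev m)) σ' H' f' h4 h3
        (fun q hq ↦ by rw [MonoidHom.map_zpowers]; exact h2 q hq) h1 hμ ⟨B₀, hB₀⟩
    · exact fun n ↦ hAdiv m (lev m) dvd_rfl n
    · intro n hn hfrob -- clause (5): invariance at every Gross depth `n` of `m` (Gross (3.3), Prop. 3.7 (1) at `p^n`)
      have hfrob' : ∀ q ∈ (lev m).primeFactors, FrobEqFrobInfty W K (p ^ n) q := by rw [hlm]; exact hfrob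
      exact map_kolyvaginPoint_mem_invPoints (hfsec m (lev m)) (hgen m (lev m) dvd_rfl) (hord m (lev m))
        (fun ℓ hℓ ↦ (IsKolyvaginPrime.pow_dvd_add_one W hp ((hlev m).2 ℓ hℓ).1 hn (hfrob' ℓ hℓ)).1)
        (fun ℓ hℓ ↦ htrg m (lev m) dvd_rfl _ ℓ hℓ
          (pow_dvd_frobeniusTrace_of_kolyvaginPrime (K := K) Dt hp hn ((hlev m).2 ℓ hℓ).1 (hfrob' ℓ hℓ)))
        (π m (lev m)) (j m (lev m)) (hj' m (lev m))

end Summit.BirchSwinnertonDyer.BirchSwinnertonDyer.Theorems.ShimuraKolyvaginOfImage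

end
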